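import Summits.CriticalPhenomena.PercolationContinuityZ3.Theorems.PercNearOneGluingNoHeavyLowerTailSahiTwoLevelIndependentTops

/-!
# PLUS′ whenever ANY two of the three top events have disjoint supports (the `S₃`-symmetric form)

Companion of `…SahiTwoLevelIndependentTops` (cell `prim-bnk`, seat bnk-2 gen 16; `--supports stmt-CriticalPhenomena-4575`).
That file proves `SahiTwoLevelPlusPrime` at every nested pair `H ≤ G` of triples of increasing events whose tops `G 0`, `G 1`
are determined by complementary sets of coins (`twoLevelPlusPrime_nonneg_of_determinedBy`).  The two-level forms are symmetric
under permuting the three slots, so the same holds for ANY pair of slots: here the PLUS′ expression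
`twoLevelForm P G H − ∏ (P(G_i) − P(H_i)) − twoLevelSlack P G H` is shown invariant under the transpositions `(1 2)` and `(0 2)`
(`plusPrime_comp_swap12`, `plusPrime_comp_swap02`; ring identities after commuting intersections), and the theorem is
re-exported as **`twoLevelPlusPrime_nonneg_of_determinedBy_pair`**: if `G i` is determined by the coins outside `T` and `G j`
(`j ≠ i`) by the coins in `T`, then PLUS′, hence `SahiTwoLevelPlus` (`twoLevelPlus_nonneg_of_determinedBy_pair`) and
`SahiTwoLevelMinus` (`twoLevelForm_nonneg_of_determinedBy_pair`) hold at `(G, H)`.  Everything proved; axioms standard;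
the general conjectures remain OPEN. [this work]
-/

noncomputable section

open scoped Classical

namespace Summit.CriticalPhenomena.PercolationContinuityZ3.Theorems

namespace SahiTwoLevelIndep

open Finset MeasureTheory
open Literature.Probability.LatticeModels (prodBernoulli)
open Literature.Probability.Percolation (DeterminedBy)

/-! ### Symmetry: any two of the three tops with disjoint supports -/

section Symmetry

variable {κ : Type*}

/-- The PLUS′ expression is invariant under exchanging the slots `1` and `2` (ring identity after commuting
intersections). [this work] -/
theorem plusPrime_comp_swap12 (P : Set (Set κ) → ℝ) (G H : Fin 3 → Set (Set κ)) :
    twoLevelForm P (G ∘ Equiv.swap (1 : Fin 3) 2) (H ∘ Equiv.swap (1 : Fin 3) 2)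
      - ∏ i, (P ((G ∘ Equiv.swap (1 : Fin 3) 2) i) - P ((H ∘ Equiv.swap (1 : Fin 3) 2) i))
      - twoLevelSlack P (G ∘ Equiv.swap (1 : Fin 3) 2) (H ∘ Equiv.swap (1 : Fin 3) 2) =
    twoLevelForm P G H - ∏ i, (P (G i) - P (H i)) - twoLevelSlack P G H := by
  have s0 : Equiv.swap (1 : Fin 3) 2 0 = 0 := by decide
  have s1 : Equiv.swap (1 : Fin 3) 2 1 = 2 := by decide
  have s2 : Equiv.swap (1 : Fin 3) 2 2 = 1 := by decide
  simp only [twoLevelForm, twoLevelSlack, Fin.prod_univ_three, Function.comp_apply, s0, s1, s2]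
  simp only [Set.inter_assoc, Set.inter_comm, Set.inter_left_comm]
  ring

/-- The PLUS′ expression is invariant under exchanging the slots `0` and `2`. [this work] -/
theorem plusPrime_comp_swap02 (P : Set (Set κ) → ℝ) (G H : Fin 3 → Set (Set κ)) :
    twoLevelForm P (G ∘ Equiv.swap (0 : Fin 3) 2) (H ∘ Equiv.swap (0 : Fin 3) 2)
      - ∏ i, (P ((G ∘ Equiv.swap (0 : Fin 3) 2) i) - P ((H ∘ Equiv.swap (0 : Fin 3) 2) i))
      - twoLevelSlack P (G ∘ Equiv.swap (0 : Fin 3) 2) (H ∘ Equiv.swap (0 : Fin 3) 2) =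
    twoLevelForm P G H - ∏ i, (P (G i) - P (H i)) - twoLevelSlack P G H := by
  have s0 : Equiv.swap (0 : Fin 3) 2 0 = 2 := by decide
  have s1 : Equiv.swap (0 : Fin 3) 2 1 = 1 := by decide
  have s2 : Equiv.swap (0 : Fin 3) 2 2 = 0 := by decide
  simp only [twoLevelForm, twoLevelSlack, Fin.prod_univ_three, Function.comp_apply, s0, s1, s2]
  simp only [Set.inter_assoc, Set.inter_comm, Set.inter_left_comm]
  ring

end Symmetry

variable {ι : Type} [Fintype ι]

/-- **PLUS′ WHENEVER ANY TWO OF THE THREE TOPS HAVE DISJOINT SUPPORTS.**  If for some `i ≠ j` the top event `G i` is determined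
by the coins outside `T` and `G j` by the coins in `T`, then `SahiTwoLevelPlusPrime` holds at `(G, H)` (all slots; by the
`S₃`-symmetry of the two-level forms). [this work] -/
theorem twoLevelPlusPrime_nonneg_of_determinedBy_pair (q : ι → unitInterval) (T : Finset ι) (G H : Fin 3 → Set (Set ι))
    (hG : ∀ i, IsUpperSet (G i)) (hH : ∀ i, IsUpperSet (H i)) (hHG : ∀ i, H i ⊆ G i)
    {i j : Fin 3} (hij : i ≠ j) (hi : DeterminedBy (G i) (↑T : Set ι)ᶜ) (hj : DeterminedBy (G j) (↑T : Set ι)) :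
    0 ≤ twoLevelForm (fun A => (prodBernoulli q).real A) G H
          - ∏ i, ((prodBernoulli q).real (G i) - (prodBernoulli q).real (H i))
          - twoLevelSlack (fun A => (prodBernoulli q).real A) G H := by
  have hi' : DeterminedBy (G i) (↑(Tᶜ) : Set ι) := by simpa using hi
  have hj' : DeterminedBy (G j) (↑(Tᶜ) : Set ι)ᶜ := by simpa using hj
  have hGs : ∀ (σ : Equiv.Perm (Fin 3)) k, IsUpperSet ((G ∘ σ) k) := fun σ k => hG (σ k)
  have hHs : ∀ (σ : Equiv.Perm (Fin 3)) k, IsUpperSet ((H ∘ σ) k) := fun σ k => hH (σ k)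
  have hHGs : ∀ (σ : Equiv.Perm (Fin 3)) k, (H ∘ σ) k ⊆ (G ∘ σ) k := fun σ k => hHG (σ k)
  have e12 := plusPrime_comp_swap12 (fun A => (prodBernoulli q).real A) G H
  have e02 := plusPrime_comp_swap02 (fun A => (prodBernoulli q).real A) G H
  fin_cases i <;> fin_cases j
  · exact absurd rfl hij
  · exact twoLevelPlusPrime_nonneg_of_determinedBy q T G H hG hH hHG hi hj
  · linarith [twoLevelPlusPrime_nonneg_of_determinedBy q T _ _ (hGs (Equiv.swap 1 2)) (hHs _) (hHGs _) hi hj]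
  · exact twoLevelPlusPrime_nonneg_of_determinedBy q Tᶜ G H hG hH hHG hj' hi'
  · exact absurd rfl hij
  · linarith [twoLevelPlusPrime_nonneg_of_determinedBy q Tᶜ _ _ (hGs (Equiv.swap 0 2)) (hHs _) (hHGs _) hj' hi']
  · linarith [twoLevelPlusPrime_nonneg_of_determinedBy q Tᶜ _ _ (hGs (Equiv.swap 1 2)) (hHs _) (hHGs _) hj' hi']
  · linarith [twoLevelPlusPrime_nonneg_of_determinedBy q T _ _ (hGs (Equiv.swap 0 2)) (hHs _) (hHGs _) hi hj]
  · exact absurd rfl hij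

/-- `SahiTwoLevelPlus` (`T⁺ ≥ 0`) whenever any two of the three tops have disjoint supports. [this work] -/
theorem twoLevelPlus_nonneg_of_determinedBy_pair (q : ι → unitInterval) (T : Finset ι) (G H : Fin 3 → Set (Set ι))
    (hG : ∀ i, IsUpperSet (G i)) (hH : ∀ i, IsUpperSet (H i)) (hHG : ∀ i, H i ⊆ G i)
    {i j : Fin 3} (hij : i ≠ j) (hi : DeterminedBy (G i) (↑T : Set ι)ᶜ) (hj : DeterminedBy (G j) (↑T : Set ι)) :
    0 ≤ twoLevelForm (fun A => (prodBernoulli q).real A) G H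
          - ∏ i, ((prodBernoulli q).real (G i) - (prodBernoulli q).real (H i)) := by
  linarith [twoLevelPlusPrime_nonneg_of_determinedBy_pair q T G H hG hH hHG hij hi hj, twoLevelSlack_nonneg q G H hHG]

/-- `SahiTwoLevelMinus` (`twoLevelForm ≥ 0`) whenever any two of the three tops have disjoint supports. [this work] -/
theorem twoLevelForm_nonneg_of_determinedBy_pair (q : ι → unitInterval) (T : Finset ι) (G H : Fin 3 → Set (Set ι))
    (hG : ∀ i, IsUpperSet (G i)) (hH : ∀ i, IsUpperSet (H i)) (hHG : ∀ i, H i ⊆ G i)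
    {i j : Fin 3} (hij : i ≠ j) (hi : DeterminedBy (G i) (↑T : Set ι)ᶜ) (hj : DeterminedBy (G j) (↑T : Set ι)) :
    0 ≤ twoLevelForm (fun A => (prodBernoulli q).real A) G H := by
  have hprod : 0 ≤ ∏ i, ((prodBernoulli q).real (G i) - (prodBernoulli q).real (H i)) :=
    prod_nonneg fun i _ => sub_nonneg.2 (measureReal_mono (hHG i))
  linarith [twoLevelPlus_nonneg_of_determinedBy_pair q T G H hG hH hHG hij hi hj]

/-! ### Compact moment forms of the two-level forms (appendix, gen 16; used in the memo's §7(c) and for the next rung) -/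

section Compact

variable {κ : Type*}

/-- **`T⁺` in five groups of moments** (ring identity, any set function `P`):
`T⁺(G,H) = 2P(G₀G₁G₂) + 2P(H₀H₁H₂) − ∏P(G_i) − Σ_k P(H_k)·[P(G_iG_j) − P(G_i)P(G_j)] − Σ_k P(G_k)·P(H_iH_j)`.
At `H = ∅` it is `2P(∩G) − ∏P(G_i)`, at `H = G` it is `2E_3(G)` in moment form. [this work] -/
theorem twoLevelPlus_eq_moments (P : Set (Set κ) → ℝ) (G H : Fin 3 → Set (Set κ)) :
    twoLevelForm P G H - ∏ i, (P (G i) - P (H i)) =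
      2 * P (G 0 ∩ G 1 ∩ G 2) + 2 * P (H 0 ∩ H 1 ∩ H 2) - P (G 0) * P (G 1) * P (G 2)
      - (P (H 0) * (P (G 1 ∩ G 2) - P (G 1) * P (G 2)) + P (H 1) * (P (G 0 ∩ G 2) - P (G 0) * P (G 2))
          + P (H 2) * (P (G 0 ∩ G 1) - P (G 0) * P (G 1)))
      - (P (G 0) * P (H 1 ∩ H 2) + P (G 1) * P (H 0 ∩ H 2) + P (G 2) * P (H 0 ∩ H 1)) := by
  simp only [twoLevelForm, Fin.prod_univ_three]
  ring

/-- **PLUS′ in three groups of moments** (ring identity, any set function `P`):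
`PLUS′(G,H) = [P(G₀G₁G₂) − ∏P(G_i)] − Σ_k P(H_k)·[P(G_iG_j) − P(G_i)P(G_j)] + Σ_k [P(H_iH_jG_k) − P(H_iH_j)P(G_k)]`;
at `H = G` it is `2E_3(G)`, so PLUS′ on an architecture of tops contains Sahi's `C_3` there. [this work] -/
theorem twoLevelPlusPrime_eq_moments (P : Set (Set κ) → ℝ) (G H : Fin 3 → Set (Set κ)) :
    twoLevelForm P G H - ∏ i, (P (G i) - P (H i)) - twoLevelSlack P G H =
      (P (G 0 ∩ G 1 ∩ G 2) - P (G 0) * P (G 1) * P (G 2))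
      - (P (H 0) * (P (G 1 ∩ G 2) - P (G 1) * P (G 2)) + P (H 1) * (P (G 0 ∩ G 2) - P (G 0) * P (G 2))
          + P (H 2) * (P (G 0 ∩ G 1) - P (G 0) * P (G 1)))
      + ((P (H 1 ∩ H 2 ∩ G 0) - P (H 1 ∩ H 2) * P (G 0)) + (P (H 0 ∩ H 2 ∩ G 1) - P (H 0 ∩ H 2) * P (G 1))
          + (P (H 0 ∩ H 1 ∩ G 2) - P (H 0 ∩ H 1) * P (G 2))) := by
  simp only [twoLevelForm, twoLevelSlack, Fin.prod_univ_three]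
  ring

end Compact


end SahiTwoLevelIndep

end Summit.CriticalPhenomena.PercolationContinuityZ3.Theorems
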